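import Literature.RepresentationTheory.AlgebraicGroups.FirstFundamentalTheoremSL
import Mathlib.RingTheory.MvPolynomial.Homogeneous
import Mathlib.Algebra.MvPolynomial.Funext
import Mathlib.Algebra.CharZero.Infinite
import Mathlib.LinearAlgebra.Matrix.MvPolynomial
import HarnessLib

/-!
# FFT for `SL_N`, step 1: homogeneous invariants are relative `GL_N`-invariants (Lemma 3.2.3)

Topic `Literature/RepresentationTheory/AlgebraicGroups`; part of the discharge of the named fact
`Sturmfels1993_thm321_FFT_SL` (B. Sturmfels, *Algorithms in Invariant Theory* (1993), Thm. 3.2.1),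
in the transposed (left multiplication, `N × M` matrices = `M` column vectors) convention of
`FirstFundamentalTheoremSL.lean`.

Contents (all proved):

* **grading**: `leftTranslate g` preserves degrees, so the homogeneous components of an
  `SL_N`-invariant are `SL_N`-invariant (`homogeneousComponent_mem_slInvariantSubalgebra`);
* **Lemma 3.2.3 (i)** [Sturmfels1993, p. 90]: every monomial of an invariant has all its
  row-degrees equal (the diagonal matrix `D(j₁,j₂) = diag(…,2,…,½,…) ∈ SL` rescales a monomial `m`
  by `2^{deg_{j₁} m - deg_{j₂} m}`), hence a homogeneous invariant of degree `n` has row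
  multi-degree `(p,…,p)`, `p = n / N` (`rowDegree_eq_div_of_mem_support`);
* **Lemma 3.2.3 (ii)**: a homogeneous `SL_N`-invariant `I` of degree `n = Np` is a relative
  `GL_N`-invariant of index `p`: `I(gX) = det(g)^p I(X)` for every complex matrix `g` with
  `det g ≠ 0` (write `g = (g Ã⁻¹) Ã`, `Ã = diag(det g,1,…,1)`) (`leftTranslate_eq_of_det_ne_zero`);
* **generic form**: the same identity with `g` the generic matrix `(t_{ij})` of indeterminates,
  `I(tX) = det(t)^p · I(X)` in `ℂ[x][t]` (`genericLeftTranslate_eq`), obtained from the pointwise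
  one by Zariski density of `GL_N(ℂ)` (a polynomial in `t` over `ℂ[x]` killed by every complex `g`
  with `det g ≠ 0` is zero: multiply by `det t` and use `MvPolynomial.funext` twice). This is the
  form "replace `v` by `t v` where `t` is a generic `n × n`-matrix … `det(t)^p J(v) = …`" used in
  Sturmfels's Ω-process arguments (§4.3, (4.3.23)).

## References

* [Sturmfels1993] B. Sturmfels, *Algorithms in Invariant Theory*, Springer 1993, §3.2,
  Lemma 3.2.3 (p. 90 of the held text); §4.3, (4.3.23).
-/

noncomputable section

open scoped BigOperators

namespace Literature.RepresentationTheory.AlgebraicGroups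

open MvPolynomial

variable {N M : ℕ}

/-! ### The action is an (anti-)homomorphism and respects the grading -/

/-- `f((gh)X) = (f(g·))(hX)`: `leftTranslate (g * h) = leftTranslate h ∘ leftTranslate g`.
[cite: Sturmfels1993, §3.2] -/
theorem leftTranslate_mul (g h : Matrix (Fin N) (Fin N) ℂ) :
    leftTranslate (M := M) (g * h) = (leftTranslate h).comp (leftTranslate g) := by
  refine MvPolynomial.algHom_ext fun p => ?_
  simp only [AlgHom.comp_apply, leftTranslate_X, map_sum, map_mul, algHom_C, algebraMap_eq,
    Matrix.mul_apply, Finset.sum_mul, Finset.mul_sum]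
  rw [Finset.sum_comm]
  refine Finset.sum_congr rfl fun k _ => Finset.sum_congr rfl fun l _ => ?_
  ring

/-- `leftTranslate g` maps homogeneous polynomials of degree `n` to homogeneous polynomials of
degree `n` (each `x_{ij}` goes to a linear form). [cite: Sturmfels1993, §3.2] -/
theorem isHomogeneous_leftTranslate (g : Matrix (Fin N) (Fin N) ℂ)
    {F : MvPolynomial (Fin N × Fin M) ℂ} {n : ℕ} (hF : F.IsHomogeneous n) :
    (leftTranslate g F).IsHomogeneous n := by
  have h := hF.aeval (fun p : Fin N × Fin M => ∑ k : Fin N, C (g p.1 k) * X (k, p.2)) (n := 1)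
    fun p => IsHomogeneous.sum _ _ _ fun k _ => isHomogeneous_C_mul_X _ _
  simpa [leftTranslate] using h

/-- Homogeneous components commute with the action. [cite: Sturmfels1993, §3.2] -/
theorem homogeneousComponent_leftTranslate (g : Matrix (Fin N) (Fin N) ℂ) (k : ℕ)
    (F : MvPolynomial (Fin N × Fin M) ℂ) :
    homogeneousComponent k (leftTranslate g F) = leftTranslate g (homogeneousComponent k F) := by
  induction F using MvPolynomial.induction_on' with
  | monomial d c =>
    have h1 : (monomial d c).IsHomogeneous d.degree := isHomogeneous_monomial _ rfl
    rw [homogeneousComponent_of_mem (isHomogeneous_leftTranslate g h1),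
      homogeneousComponent_of_mem h1]
    split_ifs <;> simp
  | add p q hp hq => simp only [map_add, hp, hq]

/-- **The invariant ring is graded**: the homogeneous components of an `SL_N`-invariant are
`SL_N`-invariant (so "we may assume that the given invariant `I` is homogeneous", Sturmfels 1993,
Lemma 3.2.3 / proof of Thm. 3.2.1). [cite: Sturmfels1993, Lemma 3.2.3] -/
theorem homogeneousComponent_mem_slInvariantSubalgebra {f : MvPolynomial (Fin N × Fin M) ℂ}
    (hf : f ∈ slInvariantSubalgebra N M) (k : ℕ) :
    homogeneousComponent k f ∈ slInvariantSubalgebra N M := by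
  rw [mem_slInvariantSubalgebra] at hf ⊢
  intro g
  rw [← homogeneousComponent_leftTranslate, hf g]

/-! ### Lemma 3.2.3: multi-homogeneity and relative invariance -/

/-- The row-degree `deg_i(m) = ∑_j m_{ij}` of a monomial `m = ∏ x_{ij}^{m_{ij}}` (the "multi-degree"
of Sturmfels 1993, §3.2, p. 90, transposed: degree in the variables of the `i`-th row).
[cite: Sturmfels1993, §3.2] -/
def rowDegree (i : Fin N) (m : Fin N × Fin M →₀ ℕ) : ℕ :=
  ∑ j : Fin M, m (i, j)

/-- The total degree is the sum of the row-degrees. [cite: Sturmfels1993, §3.2] -/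
theorem degree_eq_sum_rowDegree (m : Fin N × Fin M →₀ ℕ) :
    m.degree = ∑ i : Fin N, rowDegree i m := by
  rw [Finsupp.degree_eq_sum, Fintype.sum_prod_type]
  rfl

/-- A diagonal matrix `diag(d)` acts on the monomial `a·x^m` by the scalar `∏_i d_i^{deg_i m}`
("This matrix transforms a monomial `m` into `m · 2^{deg_{j₁}(m) - deg_{j₂}(m)}`", Sturmfels 1993,
proof of Lemma 3.2.3). [cite: Sturmfels1993, Lemma 3.2.3] -/
theorem leftTranslate_diagonal_monomial (d : Fin N → ℂ) (m : Fin N × Fin M →₀ ℕ) (a : ℂ) :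
    leftTranslate (M := M) (Matrix.diagonal d) (monomial m a) =
      monomial m (a * ∏ i, d i ^ rowDegree i m) := by
  have hX : ∀ p : Fin N × Fin M,
      leftTranslate (M := M) (Matrix.diagonal d) (X p) = C (d p.1) * X p := by
    intro p
    rw [leftTranslate_X, Finset.sum_eq_single p.1]
    · rw [Matrix.diagonal_apply_eq]
    · intro k _ hk
      rw [Matrix.diagonal_apply_ne _ (Ne.symm hk), map_zero, zero_mul]
    · intro h
      exact (h (Finset.mem_univ _)).elim
  have hφ : leftTranslate (M := M) (Matrix.diagonal d) =
      aeval fun p : Fin N × Fin M => C (d p.1) * X p :=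
    MvPolynomial.algHom_ext fun p => by rw [hX, aeval_X]
  have hw : (m.prod fun p k => d p.1 ^ k) = ∏ i, d i ^ rowDegree i m := by
    rw [Finsupp.prod_fintype _ _ fun p => pow_zero _, Fintype.prod_prod_type]
    refine Finset.prod_congr rfl fun i _ => ?_
    dsimp only
    rw [Finset.prod_pow_eq_pow_sum]
    rfl
  rw [hφ, aeval_monomial, algebraMap_eq, ← hw]
  simp_rw [mul_pow]
  rw [Finsupp.prod_mul]
  have h2 : (m.prod fun p k => (X p : MvPolynomial (Fin N × Fin M) ℂ) ^ k) = monomial m 1 :=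
    prod_X_pow_eq_monomial
  have h3 : (m.prod fun p k => (C (d p.1) : MvPolynomial (Fin N × Fin M) ℂ) ^ k) =
      C (m.prod fun p k => d p.1 ^ k) := by
    simp only [map_finsuppProd, map_pow]
  rw [h2, h3, ← mul_assoc, ← map_mul, C_mul_monomial, mul_one]

/-- Coefficientwise form: `coeff_m (f ∘ diag(d)) = (∏_i d_i^{deg_i m}) · coeff_m f`.
[cite: Sturmfels1993, Lemma 3.2.3] -/
theorem coeff_leftTranslate_diagonal (d : Fin N → ℂ) (f : MvPolynomial (Fin N × Fin M) ℂ)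
    (m : Fin N × Fin M →₀ ℕ) :
    coeff m (leftTranslate (Matrix.diagonal d) f) = (∏ i, d i ^ rowDegree i m) * coeff m f := by
  classical
  induction f using MvPolynomial.induction_on' with
  | monomial m' a =>
    rw [leftTranslate_diagonal_monomial, coeff_monomial, coeff_monomial]
    split_ifs with h
    · subst h
      ring
    · rw [mul_zero]
  | add p q hp hq => rw [map_add, coeff_add, coeff_add, hp, hq, mul_add]

/-- **Lemma 3.2.3 (i)** (Sturmfels 1993): every monomial occurring in an `SL_N`-invariant has
all its row-degrees equal (apply the invariance to `D(j₁,j₂) = diag(…, 2, …, ½, …) ∈ SL_N(ℂ)`,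
which rescales the monomial by `2^{deg_{j₁} m - deg_{j₂} m}`). [cite: Sturmfels1993, Lemma 3.2.3] -/
theorem rowDegree_eq_of_mem_support {f : MvPolynomial (Fin N × Fin M) ℂ}
    (hf : f ∈ slInvariantSubalgebra N M) {m : Fin N × Fin M →₀ ℕ} (hm : m ∈ f.support)
    (i i' : Fin N) : rowDegree i m = rowDegree i' m := by
  by_cases hii : i = i'
  · rw [hii]
  set d : Fin N → ℂ := fun k => if k = i then 2 else if k = i' then 2⁻¹ else 1 with hd
  have hdi : d i = 2 := by simp [hd]
  have hdi' : d i' = 2⁻¹ := by simp [hd, Ne.symm hii]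
  have hdk : ∀ k, k ≠ i ∧ k ≠ i' → d k = 1 := fun k hk => by simp [hd, hk.1, hk.2]
  have hdet : (Matrix.diagonal d).det = 1 := by
    rw [Matrix.det_diagonal, Finset.prod_eq_mul i i' hii (fun k _ hk => hdk k hk)
      (fun h => (h (Finset.mem_univ _)).elim) (fun h => (h (Finset.mem_univ _)).elim), hdi, hdi',
      mul_inv_cancel₀ two_ne_zero]
  have hinv := (mem_slInvariantSubalgebra.1 hf) ⟨Matrix.diagonal d, hdet⟩
  have hc := congrArg (coeff m) hinv
  rw [Matrix.SpecialLinearGroup.coe_mk, coeff_leftTranslate_diagonal,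
    Finset.prod_eq_mul i i' hii (fun k _ hk => by rw [hdk k hk, one_pow])
      (fun h => (h (Finset.mem_univ _)).elim) (fun h => (h (Finset.mem_univ _)).elim),
    hdi, hdi'] at hc
  have hcoeff : coeff m f ≠ 0 := mem_support_iff.1 hm
  have h1 : (2 : ℂ) ^ rowDegree i m * (2⁻¹) ^ rowDegree i' m = 1 :=
    mul_right_cancel₀ hcoeff (hc.trans (one_mul _).symm)
  rw [inv_pow, mul_inv_eq_one₀ (pow_ne_zero _ two_ne_zero)] at h1
  have h2 : (2 ^ rowDegree i m : ℕ) = 2 ^ rowDegree i' m := by exact_mod_cast h1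
  exact Nat.pow_right_injective (le_refl 2) h2

/-- **Lemma 3.2.3 (i), homogeneous case**: a homogeneous `SL_N`-invariant of degree `n` has row
multi-degree `(p, p, …, p)` with `p = n / N` on every monomial of its support.
[cite: Sturmfels1993, Lemma 3.2.3] -/
theorem rowDegree_eq_div_of_mem_support {f : MvPolynomial (Fin N × Fin M) ℂ}
    (hf : f ∈ slInvariantSubalgebra N M) {n : ℕ} (hn : f.IsHomogeneous n) (hN : 0 < N)
    {m : Fin N × Fin M →₀ ℕ} (hm : m ∈ f.support) (i : Fin N) : rowDegree i m = n / N := by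
  have hdeg : m.degree = n := by
    rw [Finsupp.degree_apply]
    exact (hn.degree_eq_sum_deg_support hm).symm
  have hsum := degree_eq_sum_rowDegree m
  rw [Finset.sum_congr rfl fun k _ => rowDegree_eq_of_mem_support hf hm k i, Finset.sum_const,
    Finset.card_univ, Fintype.card_fin, smul_eq_mul, hdeg] at hsum
  rw [hsum, Nat.mul_div_cancel_left _ hN]

/-- The degree of a non-zero homogeneous `SL_N`-invariant is a multiple of `N`: `n = N · (n / N)`.
[cite: Sturmfels1993, Lemma 3.2.3] -/
theorem degree_eq_mul_div_of_mem {f : MvPolynomial (Fin N × Fin M) ℂ}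
    (hf : f ∈ slInvariantSubalgebra N M) {n : ℕ} (hn : f.IsHomogeneous n) (hN : 0 < N)
    (hf0 : f ≠ 0) : n = N * (n / N) := by
  obtain ⟨m, hm⟩ := support_nonempty.2 hf0
  have hdeg : m.degree = n := by
    rw [Finsupp.degree_apply]
    exact (hn.degree_eq_sum_deg_support hm).symm
  have hsum := degree_eq_sum_rowDegree m
  rw [Finset.sum_congr rfl fun k _ => rowDegree_eq_div_of_mem_support hf hn hN hm k,
    Finset.sum_const, Finset.card_univ, Fintype.card_fin, smul_eq_mul, hdeg] at hsum
  exact hsum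

/-- The row-scaling `diag(1,…,a,…,1)` (`a` in row `i₀`) multiplies a homogeneous invariant of
degree `n` by `a^{n/N}` ("`I ∘ Ã = det(A)^p · I`" in the proof of Lemma 3.2.3 (ii)).
[cite: Sturmfels1993, Lemma 3.2.3] -/
theorem leftTranslate_rowScale {f : MvPolynomial (Fin N × Fin M) ℂ}
    (hf : f ∈ slInvariantSubalgebra N M) {n : ℕ} (hn : f.IsHomogeneous n) (i₀ : Fin N) (a : ℂ) :
    leftTranslate (Matrix.diagonal fun k => if k = i₀ then a else 1) f = C (a ^ (n / N)) * f := by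
  refine MvPolynomial.ext _ _ fun m => ?_
  rw [coeff_leftTranslate_diagonal, coeff_C_mul]
  by_cases hm : m ∈ f.support
  · congr 1
    rw [Finset.prod_eq_single i₀ (fun k _ hk => by rw [if_neg hk, one_pow])
      (fun h => (h (Finset.mem_univ _)).elim), if_pos rfl,
      rowDegree_eq_div_of_mem_support hf hn (Fin.pos i₀) hm i₀]
  · rw [notMem_support_iff.1 hm, mul_zero, mul_zero]

/-- **Lemma 3.2.3 (ii)** (Sturmfels 1993): a homogeneous `SL_N(ℂ)`-invariant `I` of degree `n`
is a relative `GL_N(ℂ)`-invariant of index `p = n/N`: `I(gX) = det(g)^p · I(X)` for every complex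
`N × N` matrix `g` with `det g ≠ 0` (write `g = (g Ã⁻¹) · Ã` with `Ã = diag(det g, 1, …, 1)` and
`g Ã⁻¹ ∈ SL_N(ℂ)`). [cite: Sturmfels1993, Lemma 3.2.3] -/
theorem leftTranslate_eq_of_det_ne_zero {f : MvPolynomial (Fin N × Fin M) ℂ}
    (hf : f ∈ slInvariantSubalgebra N M) {n : ℕ} (hn : f.IsHomogeneous n) (hN : 0 < N)
    (g : Matrix (Fin N) (Fin N) ℂ) (hg : g.det ≠ 0) :
    leftTranslate g f = C (g.det ^ (n / N)) * f := by
  set i₀ : Fin N := ⟨0, hN⟩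
  set Da : Matrix (Fin N) (Fin N) ℂ := Matrix.diagonal fun k => if k = i₀ then g.det else 1
    with hDa
  set Di : Matrix (Fin N) (Fin N) ℂ := Matrix.diagonal fun k => if k = i₀ then g.det⁻¹ else 1
    with hDi
  have hD : Di * Da = 1 := by
    rw [hDi, hDa, Matrix.diagonal_mul_diagonal, ← Matrix.diagonal_one]
    congr 1
    funext k
    split_ifs <;> simp [hg]
  have hdetS : (g * Di).det = 1 := by
    rw [Matrix.det_mul, hDi, Matrix.det_diagonal,
      Finset.prod_eq_single i₀ (fun k _ hk => by rw [if_neg hk])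
        (fun h => (h (Finset.mem_univ _)).elim), if_pos rfl, mul_inv_cancel₀ hg]
  have hg' : g = (g * Di) * Da := by rw [Matrix.mul_assoc, hD, Matrix.mul_one]
  have hinv := (mem_slInvariantSubalgebra.1 hf) ⟨g * Di, hdetS⟩
  rw [Matrix.SpecialLinearGroup.coe_mk] at hinv
  conv_lhs => rw [hg', leftTranslate_mul, AlgHom.comp_apply, hinv]
  exact leftTranslate_rowScale hf hn i₀ g.det

/-! ### The generic matrix: `I(tX) = det(t)^p I(X)` in `ℂ[x][t]` -/

variable (N M) in
/-- The polynomial ring `ℂ[x_{ij}][t_{kl}]` in the entries of a generic `N × N` matrix `t` over the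
coordinate ring `ℂ[x_{ij}]` of `N × M` matrices (Sturmfels 1993, §4.3: "`f(t v)` is a polynomial
… both in `t` and in `v`"; the `x`-coordinates are "regarded as constants").
[cite: Sturmfels1993, §4.3] -/
abbrev GenRing : Type := MvPolynomial (Fin N × Fin N) (MvPolynomial (Fin N × Fin M) ℂ)

variable (N M) in
/-- **Generic left translation** `F ↦ F(tX)`: the `ℂ`-algebra map `ℂ[x] → ℂ[x][t]`,
`x_{ij} ↦ ∑_k t_{ik} x_{kj}` ("we replace `v` by `t v` where `t` is a generic `n × n`-matrix",
Sturmfels 1993, §4.3). [cite: Sturmfels1993, §4.3] -/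
def genericLeftTranslate : MvPolynomial (Fin N × Fin M) ℂ →ₐ[ℂ] GenRing N M :=
  aeval fun p : Fin N × Fin M => ∑ k : Fin N, X (p.1, k) * C (X (k, p.2))

/-- On a coordinate: `x_{ij} ↦ ∑_k t_{ik} x_{kj}`. [cite: Sturmfels1993, §4.3] -/
@[simp] theorem genericLeftTranslate_X (p : Fin N × Fin M) :
    genericLeftTranslate N M (X p) = ∑ k : Fin N, X (p.1, k) * C (X (k, p.2)) :=
  aeval_X _ p

/-- Specialising the generic matrix `t` to a complex matrix `g`: the `ℂ[x]`-algebra map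
`ℂ[x][t] → ℂ[x]`, `t_{kl} ↦ g_{kl}`. [cite: Sturmfels1993, §4.3] -/
def evalGen (g : Matrix (Fin N) (Fin N) ℂ) :
    GenRing N M →ₐ[MvPolynomial (Fin N × Fin M) ℂ] MvPolynomial (Fin N × Fin M) ℂ :=
  aeval fun q : Fin N × Fin N => C (g q.1 q.2)

/-- Specialising `F(tX)` at `t = g` gives `F(gX)`. [cite: Sturmfels1993, §4.3] -/
theorem evalGen_genericLeftTranslate (g : Matrix (Fin N) (Fin N) ℂ)
    (F : MvPolynomial (Fin N × Fin M) ℂ) :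
    evalGen g (genericLeftTranslate N M F) = leftTranslate g F := by
  suffices h : ((evalGen (M := M) g).restrictScalars ℂ).comp (genericLeftTranslate N M) =
      leftTranslate g from DFunLike.congr_fun h F
  refine MvPolynomial.algHom_ext fun p => ?_
  simp [evalGen, leftTranslate_X]

/-- Specialising `det t` at `t = g` gives the constant `det g`. [folklore] -/
theorem evalGen_det (g : Matrix (Fin N) (Fin N) ℂ) :
    evalGen (M := M) g (Matrix.mvPolynomialX (Fin N) (Fin N) _).det = C g.det := by
  rw [AlgHom.map_det]
  have h : (evalGen (M := M) g).mapMatrix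
      (Matrix.mvPolynomialX (Fin N) (Fin N) (MvPolynomial (Fin N × Fin M) ℂ)) = g.map C := by
    ext i j
    simp [evalGen]
  rw [h, ← RingHom.mapMatrix_apply, ← RingHom.map_det]

/-- Evaluating first `t := g` and then `x := ξ` is evaluating the `t`-polynomial with the
`ξ`-evaluated coefficients at `g`. [folklore] -/
theorem eval_evalGen (ξ : Fin N × Fin M → ℂ) (g : Matrix (Fin N) (Fin N) ℂ) (E : GenRing N M) :
    eval ξ (evalGen g E) = eval (fun q : Fin N × Fin N => g q.1 q.2) (MvPolynomial.map (eval ξ) E) := by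
  have h : (eval ξ).comp (evalGen (M := M) g : GenRing N M →+* MvPolynomial (Fin N × Fin M) ℂ) =
      (eval fun q : Fin N × Fin N => g q.1 q.2).comp (MvPolynomial.map (eval ξ)) := by
    refine MvPolynomial.ringHom_ext (fun r => ?_) (fun q => ?_)
    · simp [evalGen]
    · simp [evalGen]
  exact RingHom.congr_fun h E

/-- **Zariski density of `GL_N(ℂ)`**: a polynomial in the generic matrix `t` with coefficients in
`ℂ[x]` that vanishes under every specialisation `t := g`, `g ∈ GL_N(ℂ)`, is zero (its product
with `det t` vanishes at every complex point; `ℂ` is infinite; `det t ≠ 0` in the domain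
`ℂ[x][t]`). [folklore] -/
theorem genRing_eq_zero_of_forall_evalGen {D : GenRing N M}
    (h : ∀ g : Matrix (Fin N) (Fin N) ℂ, g.det ≠ 0 → evalGen g D = 0) : D = 0 := by
  set E : GenRing N M := D * (Matrix.mvPolynomialX (Fin N) (Fin N) _).det with hE
  have hEval : ∀ g : Matrix (Fin N) (Fin N) ℂ, evalGen (M := M) g E = 0 := by
    intro g
    rw [hE, map_mul, evalGen_det]
    by_cases hg : g.det = 0
    · rw [hg, map_zero, mul_zero]
    · rw [h g hg, zero_mul]
  have hE0 : E = 0 := by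
    refine MvPolynomial.ext _ _ fun β => ?_
    rw [coeff_zero]
    refine MvPolynomial.funext fun ξ => ?_
    rw [map_zero]
    have hmap : MvPolynomial.map (eval ξ) E = 0 := by
      refine MvPolynomial.funext fun g' => ?_
      rw [map_zero]
      have h1 := congrArg (eval ξ) (hEval (Matrix.of fun i j => g' (i, j)))
      rw [map_zero, eval_evalGen] at h1
      simpa using h1
    have h2 := congrArg (coeff β) hmap
    rwa [coeff_map, coeff_zero] at h2
  exact (mul_eq_zero.1 hE0).resolve_right (Matrix.det_mvPolynomialX_ne_zero _ _)

/-- **The generic relative invariance** (Lemma 3.2.3 (ii) for the generic matrix, as used in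
Sturmfels 1993, §4.3, (4.3.23)): a homogeneous `SL_N`-invariant `I` of degree `n` satisfies
`I(tX) = det(t)^{n/N} · I(X)` identically in the indeterminates `t_{kl}, x_{ij}`.
[cite: Sturmfels1993, Lemma 3.2.3 and (4.3.23)] -/
theorem genericLeftTranslate_eq {f : MvPolynomial (Fin N × Fin M) ℂ}
    (hf : f ∈ slInvariantSubalgebra N M) {n : ℕ} (hn : f.IsHomogeneous n) (hN : 0 < N) :
    genericLeftTranslate N M f =
      (Matrix.mvPolynomialX (Fin N) (Fin N) _).det ^ (n / N) * C f := by
  rw [← sub_eq_zero]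
  refine genRing_eq_zero_of_forall_evalGen fun g hg => ?_
  rw [map_sub, map_mul, map_pow, evalGen_genericLeftTranslate, evalGen_det,
    leftTranslate_eq_of_det_ne_zero hf hn hN g hg, ← map_pow, sub_eq_zero]
  simp [evalGen]

end Literature.RepresentationTheory.AlgebraicGroups

end
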